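import Summits.RiemannHypothesis.RiemannHypothesis.Theorems.JensenPolynomialsXiGorttwCoeffSmallTableCert
import Summits.RiemannHypothesis.RiemannHypothesis.Theorems.JensenPolynomialsChainDefs
import Literature.NumberTheory.LFunctions.XiTaylorRatioCentresHi128A
import Literature.NumberTheory.LFunctions.XiTaylorRatioCentresHi128B
import HarnessLib

/-!
# E-CANARY-128 (route `JensenLogBand`, support item `XiDerivEdgeReal`, PLAN-ONLY line «E-CANARY-128») — D3 file 2/8:
# the canary statements, the data box, the normalised row function and the arithmetic/analytic CONTRACT

RH-FREE. The kernel canary (theory g10, `E-CANARY-TIER2-DESIGN.md`; director-rh g8 2026-08-27 «D3 = GO») is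
`XiDerivDiscRealCanary128`: every zero `z` of `ξ₁⁽¹²⁸⁾ = iteratedDeriv 128 xiSq` with `‖z‖ ≤ 64·(128/log 128)²` is real.
It will be proved CONDITIONALLY on ONE enclosure hypothesis in the evidence class of the TABLE crux
(`CoeffTable.RatioEncloses`, certified numerics of two code-disjoint lineages, NOT a kernel fact):
`RatioEncloses xiRatioBoxHi128 xiTaylorCoeffFrom128`, i.e. `(c_m − 1)/10²⁴⁰ ≤ γ(m+1)/γ(m) ≤ (c_m + 1)/10²⁴⁰` for the
`1024` integer centres of `Literature…XiTaylorRatioCentresHi128A/B` (`m = 128 … 1151`).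

This file fixes NAMES and the CONTRACT between the two halves of the checker:
* `canaryF z = 8·ξ₁⁽¹²⁸⁾(z)/γ(128) = Σ_k canaryR k · z^k/k!`, `canaryR k = γ(128+k)/γ(128)`, `canaryRho m = γ(m+1)/γ(m)`;
* the FINITE real quantities the interval checker encloses: partial sums `canaryS j N z = Σ_{k ≤ N−j} r_{k+j} z^k/k!`,
  the majorant `canaryFmaj N x = Σ_{k≤N} r_k x^k/k!`, the geometric truncation allowance `canaryTrunc j N x` and the
  Taylor-remainder allowance `canaryTaylorTail K J h`;
* `PieceIneq` — the inequality among these finite quantities which (arithmetic half, `…CanarySeries`) the checker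
  certifies from the box, and which (analytic half, `…CanaryAnalytic`) implies Henrici's step rule
  `0 < Re (canaryF z / I^d)` on the piece of half-length `h = L/2` centred at `z_c = (a + b·I)/2`; `AxisIneq` — the sign
  of `canaryF` at a real point.
Nothing here bears on the truth of RH.
-/

-- D-0017: the doubled namespace is by design.
set_option linter.dupNamespace false

noncomputable section

namespace Summit.RiemannHypothesis.RiemannHypothesis.Theorems.JensenPolynomials.LogBand.Canary

open Literature.NumberTheory.LFunctions Complex
open Summit.RiemannHypothesis.RiemannHypothesis.Theorems.JensenPolynomials
open Summit.RiemannHypothesis.RiemannHypothesis.Theorems.JensenPolynomials.CoeffTable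
open scoped Nat

/-! ## The canary statements (verbatim from theory g10's `CanarySig.lean`) -/

/-- E-CANARY target, annulus form: the `n = 128` instance of `JensenLogBand.XiDerivEdgeReal` — every zero of
`ξ₁⁽¹²⁸⁾` with `chainRadius 128 ≤ ‖z‖ ≤ 64·(128/log 128)²` is real. RH-FREE. -/
def XiDerivEdgeRealCanary128 : Prop :=
  ∀ z : ℂ, iteratedDeriv 128 xiSq z = 0 → chainRadius 128 ≤ ‖z‖ →
    ‖z‖ ≤ 64 * ((128 : ℝ) / Real.log 128) ^ 2 → z.im = 0

/-- E-CANARY target, disc form (what the certificate decides directly; implies the annulus form): every zero of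
`ξ₁⁽¹²⁸⁾` with `‖z‖ ≤ 64·(128/log 128)²` is real. RH-FREE. -/
def XiDerivDiscRealCanary128 : Prop :=
  ∀ z : ℂ, iteratedDeriv 128 xiSq z = 0 → ‖z‖ ≤ 64 * ((128 : ℝ) / Real.log 128) ^ 2 → z.im = 0

/-- The disc form implies the annulus form. -/
theorem canary_of_disc (h : XiDerivDiscRealCanary128) : XiDerivEdgeRealCanary128 :=
  fun z hz _ hle => h z hz hle

/-! ## The data box and the enclosure hypothesis -/

/-- The `1024` integer centres `c_m`, `m = 128 … 1151` (files `XiTaylorRatioCentresHi128A/B`). -/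
def xiRatioCentresHi128 : List ℕ := xiRatioCentresHi128A ++ xiRatioCentresHi128B

/-- The hi-precision ratio box: intervals `[(c_m − 1)/10²⁴⁰, (c_m + 1)/10²⁴⁰]`, entry `i` ↦ `m = 128 + i`. -/
def xiRatioBoxHi128 : List Iv := mkBox 240 xiRatioCentresHi128

/-- The Taylor coefficients from index `128` on: `xiTaylorCoeffFrom128 m = γ(128 + m)`; the ENCLOSURE HYPOTHESIS of
the canary is `RatioEncloses xiRatioBoxHi128 xiTaylorCoeffFrom128` (entry `i` encloses `γ(129+i)/γ(128+i)`). -/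
def xiTaylorCoeffFrom128 (m : ℕ) : ℝ := xiTaylorCoeff (128 + m)

/-! ## The normalised row function and its coefficients -/

/-- `canaryR k = γ(128+k)/γ(128)` (`= Π_{i<k} canaryRho (128+i)`; `canaryR 0 = 1`). -/
def canaryR (k : ℕ) : ℝ := xiTaylorCoeff (128 + k) / xiTaylorCoeff 128

/-- `canaryRho m = γ(m+1)/γ(m)`, the consecutive ratio (strictly decreasing in `m`: Turán/CNV,
tree `WangYang2024.xiTaylorCoeff_mul_lt_sq`). -/
def canaryRho (m : ℕ) : ℝ := xiTaylorCoeff (m + 1) / xiTaylorCoeff m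

/-- The normalised `128`-th row function `canaryF z = 8·ξ₁⁽¹²⁸⁾(z)/γ(128)` (so `canaryF z = Σ_k canaryR k · z^k/k!`
by the tree's `hasSum_xiTaylorCoeff_shift`, `canaryF 0 = 1`, and `canaryF z = 0 ↔ ξ₁⁽¹²⁸⁾(z) = 0`). -/
def canaryF (z : ℂ) : ℂ := 8 * iteratedDeriv 128 xiSq z / (xiTaylorCoeff 128 : ℂ)

/-! ## The finite quantities of the contract -/

/-- Partial sum of the `j`-th derivative series: `canaryS j N z = Σ_{k=0}^{N−j} canaryR (k+j) · z^k / k!`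
(encloses `canaryF⁽ʲ⁾(z)` up to `canaryTrunc j N ‖z‖`). -/
def canaryS (j N : ℕ) (z : ℂ) : ℂ :=
  ∑ k ∈ Finset.range (N - j + 1), (canaryR (k + j) : ℂ) * z ^ k / (k ! : ℂ)

/-- Truncated majorant `canaryFmaj N x = Σ_{k=0}^{N} canaryR k · x^k / k!` (`x ≥ 0`). -/
def canaryFmaj (N : ℕ) (x : ℝ) : ℝ :=
  ∑ k ∈ Finset.range (N + 1), canaryR k * x ^ k / k !

/-- Ratio bound for the series truncation after index `N − j`: `canaryTruncQ j N x = canaryRho (129 + N) · x / (N − j + 2)`. -/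
def canaryTruncQ (j N : ℕ) (x : ℝ) : ℝ := canaryRho (129 + N) * x / ((N - j + 2 : ℕ) : ℝ)

/-- Geometric truncation allowance `canaryTrunc j N x = canaryR (N+1) · x^{N−j+1}/(N−j+1)! / (1 − canaryTruncQ j N x)`
(`≥ Σ_{k > N−j} canaryR (k+j) x^k/k!` when `canaryTruncQ j N x < 1`, by monotonicity of `canaryRho`). -/
def canaryTrunc (j N : ℕ) (x : ℝ) : ℝ :=
  canaryR (N + 1) * x ^ (N - j + 1) / ((N - j + 1) ! : ℝ) / (1 - canaryTruncQ j N x)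

/-- Ratio bound for the Taylor remainder after order `K + J`: `canaryTaylorQ K J h = canaryRho (129 + K + J) · h / (K + J + 2)`. -/
def canaryTaylorQ (K J : ℕ) (h : ℝ) : ℝ := canaryRho (129 + K + J) * h / ((K + J + 2 : ℕ) : ℝ)

/-- Taylor-remainder allowance `canaryTaylorTail K J h = Σ_{j=K+1}^{K+J} canaryR j h^j/j! +
canaryR (K+J+1) h^{K+J+1}/(K+J+1)! / (1 − canaryTaylorQ K J h)` (`≥ Σ_{j>K} canaryR j h^j/j!` when `canaryTaylorQ < 1`). -/
def canaryTaylorTail (K J : ℕ) (h : ℝ) : ℝ :=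
  (∑ j ∈ Finset.Ico (K + 1) (K + J + 1), canaryR j * h ^ j / j !) +
    canaryR (K + J + 1) * h ^ (K + J + 1) / ((K + J + 1) ! : ℝ) / (1 - canaryTaylorQ K J h)

/-- The piece centre `z_c = (a + b·I)/2` of a piece with doubled integer coordinates `a`, `b`. -/
def pieceCentre (a b : ℤ) : ℂ := ((a : ℂ) + (b : ℂ) * I) / 2

/-! ## The contract -/

/-- **`PieceIneq a b L d K N J xbar`** — the finite inequality certified by the interval checker for the piece with centre
`z_c = (a+b·I)/2`, length `L` (half-length `h = L/2`), quarter label `d` (anchor `I^d`), Taylor order `K`, truncation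
index `N`, Taylor-tail length `J` and radius bound `xbar ≥ ‖z_c‖`:
side conditions `K + 1 ≤ N`, `‖z_c‖ ≤ xbar`, `canaryTruncQ K N xbar < 1`, `canaryTaylorQ K J h < 1`, and
`Re(canaryS 0 N z_c / I^d) − canaryTrunc 0 N xbar >
   Σ_{j=1}^{K} (‖canaryS j N z_c‖ + canaryTrunc j N xbar) h^j/j! + (canaryFmaj N xbar + canaryTrunc 0 N xbar) · canaryTaylorTail K J h`.
The analytic half shows it implies `0 < Re (canaryF z / I^d)` for every `z` with `‖z − z_c‖ ≤ h`. -/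
def PieceIneq (a b : ℤ) (L d K N J xbar : ℕ) : Prop :=
  let zc := pieceCentre a b
  let h : ℝ := (L : ℝ) / 2
  K + 1 ≤ N ∧ ‖zc‖ ≤ (xbar : ℝ) ∧ canaryTruncQ K N xbar < 1 ∧ canaryTaylorQ K J h < 1 ∧
    (∑ j ∈ Finset.Icc 1 K, (‖canaryS j N zc‖ + canaryTrunc j N xbar) * h ^ j / (j ! : ℝ)) +
        (canaryFmaj N xbar + canaryTrunc 0 N xbar) * canaryTaylorTail K J h <
      (canaryS 0 N zc / I ^ d).re - canaryTrunc 0 N xbar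

/-- **`AxisIneq a d N xbar`** — the finite inequality certified at the real point `t = a/2`: `1 ≤ N`, `|t| ≤ xbar`,
`canaryTruncQ 0 N xbar < 1` and `Re(canaryS 0 N t / I^d) > canaryTrunc 0 N xbar`; with `d = 0` it yields
`0 < canaryF t`, with `d = 2` it yields `canaryF t < 0` (as real numbers). -/
def AxisIneq (a : ℤ) (d N xbar : ℕ) : Prop :=
  let t := pieceCentre a 0
  1 ≤ N ∧ ‖t‖ ≤ (xbar : ℝ) ∧ canaryTruncQ 0 N xbar < 1 ∧
    canaryTrunc 0 N xbar < (canaryS 0 N t / I ^ d).re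

end Summit.RiemannHypothesis.RiemannHypothesis.Theorems.JensenPolynomials.LogBand.Canary

end
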